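import Literature.Topology.FourManifolds.HomotopySpheresGroupProofs
import Literature.Topology.FourManifolds.ConnectedSumProofs
import Literature.AlgebraicTopology.Homotopy.HomotopyGroupsGeneralPosition
import Literature.AlgebraicTopology.Homotopy.BallComplementRetract
import HarnessLib

/-!
# Punctured homotopy spheres: connectivity and simple connectivity of `Σ ∖ {p}` and `Σ ∖ i (B)`

Topic `Literature/Topology/FourManifolds`, sibling of `HomotopySpheres.lean`. First (fundamental
group) half of the classical proof of the named fact
`Literature.Topology.FourManifolds.HomotopySphere.contractibleSpace_compl_image_ball` (`HomotopySpheresSum.lean`; Kosinski,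
*Differential Manifolds* (1993), VI §1: "if `Σ` is a homotopy sphere, then `Σ` with the
interior of a disc deleted is a contractible manifold"), which for `n ≥ 3` runs: `Σ ∖ i (B)` is
simply connected and acyclic, hence contractible (Hurewicz–Whitehead). Everything here is
proved:

* (inputs from the tree: `Literature.Topology.FourManifolds.HomotopySphere.pathConnectedSpace`, `n ≠ 0`,
  `HomotopySpheresProofs.lean`; `Literature.Topology.FourManifolds.HomotopySphere.simplyConnectedSpace`, `n ≥ 2`,
  `HomotopySpheresGroupProofs.lean`.)
* `Literature.Topology.FourManifolds.isOpenEmbedding_of_isSmoothEmbedding_euclidean`: a smooth disc `i : ℝⁿ → M` in an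
  `n`-manifold is an open embedding (equal dimensions:
  `Literature.Topology.FourManifolds.isOpen_range_of_isImmersion_of_finrank_le`, tree).
* `Literature.Topology.FourManifolds.HomotopySphere.isPathConnected_compl_singleton` (`n ≥ 2`),
  `Literature.Topology.FourManifolds.HomotopySphere.simplyConnectedSpace_compl_singleton` (`n ≥ 3`): removing a point
  (general position, `SimplyConnectedComplPoint.lean`, tree; Kosinski VI.2, "for `m ≥ 3`").
* `Literature.Topology.FourManifolds.HomotopySphere.simplyConnectedSpace_compl_image_ball` (`n ≥ 3`): `Σ ∖ i (B)` is simply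
  connected, being a deformation retract of `Σ ∖ {i 0}` (`Literature.AlgebraicTopology.Homotopy.BallComplement.homotopyEquiv`,
  `Literature/AlgebraicTopology/Homotopy/BallComplementRetract.lean`).

## References

* A. Kosinski, *Differential Manifolds*, Academic Press (1993), Ch. VI §§1–2. [Kosinski1993]
* A. Hatcher, *Algebraic Topology*, CUP (2002), Prop. 1.14, proof of Thm. 2.26. [HatcherAT2002]
* M. Kervaire, J. Milnor, *Groups of homotopy spheres I*, Ann. of Math. 77 (1963), §2.
  [KervaireMilnorAnnals1963]
-/

open scoped Manifold ContDiff Topology ContinuousMap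
open Set Function Metric Module Topology

noncomputable section

namespace Literature.Topology.FourManifolds

/-- Local notation: `𝔼 n` is the model Euclidean space `EuclideanSpace ℝ (Fin n)`. -/
local notation "𝔼 " n:arg => EuclideanSpace ℝ (Fin n)

/-- Local notation: `𝕊 n` is the unit sphere in `EuclideanSpace ℝ (Fin (n + 1))`. -/
local notation "𝕊 " n:arg => (Metric.sphere (0 : EuclideanSpace ℝ (Fin (n + 1))) 1)

variable {n : ℕ}

/-! ### Smooth discs are open embeddings -/

/-- **A smooth embedding `ℝⁿ → M` into an `n`-manifold is an open embedding** (an immersion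
between manifolds of the same finite dimension has open range; Kosinski, *Differential
Manifolds* (1993), IV.1). [folklore] -/
theorem isOpenEmbedding_of_isSmoothEmbedding_euclidean {M : Type*} [TopologicalSpace M]
    [ChartedSpace (𝔼 n) M] {i : 𝔼 n → M}
    (hi : Manifold.IsSmoothEmbedding 𝓘(ℝ, 𝔼 n) (𝓡 n) ∞ i) : IsOpenEmbedding i :=
  ⟨hi.isEmbedding, isOpen_range_of_isImmersion_of_finrank_le hi.isImmersion le_rfl⟩

namespace HomotopySphere

/-! ### Removing a point -/

/-- **A homotopy `n`-sphere minus a point is path connected** for `n ≥ 2` (general position: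
paths can be pushed off a point in dimension `≥ 2`; Kosinski VI.1.1). [folklore] -/
theorem isPathConnected_compl_singleton (S : HomotopySphere n) (hn : 2 ≤ n) (p : S.carrier) :
    IsPathConnected ({p}ᶜ : Set S.carrier) := by
  haveI := S.pathConnectedSpace (by omega)
  refine Literature.AlgebraicTopology.Homotopy.isPathConnected_compl_singleton_of_chartedSpace (E := 𝔼 n) ?_ p
  rw [finrank_euclideanSpace_fin]
  omega

/-- **A homotopy `n`-sphere minus a point is simply connected** for `n ≥ 3`: the homotopy
sphere is simply connected (`n ≥ 2`) and a null-homotopy of a loop avoiding `p` can be pushed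
off `p` in dimension `≥ 3` (Kosinski, *Differential Manifolds* (1993), VI.2, "for `m ≥ 3`";
tree lemma `isSimplyConnected_compl_singleton_of_isOpenEmbedding`). [cite: Kosinski1993, Ch. VI §2] -/
theorem simplyConnectedSpace_compl_singleton (S : HomotopySphere n) (hn : 3 ≤ n)
    (p : S.carrier) : SimplyConnectedSpace ↥(({p}ᶜ : Set S.carrier)) := by
  haveI := HomotopySphere.simplyConnectedSpace (by omega) S
  obtain ⟨i, hi, rfl⟩ := Literature.AlgebraicTopology.Homotopy.exists_isOpenEmbedding_apply_zero_eq (E := 𝔼 n) p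
  refine (Literature.AlgebraicTopology.FundamentalGroupoid.isSimplyConnected_compl_singleton_of_isOpenEmbedding hi ?_).simplyConnectedSpace
  rw [finrank_euclideanSpace_fin]
  omega

/-! ### Removing an open disc -/

/-- **A homotopy `n`-sphere with the interior of a disc deleted is simply connected** for
`n ≥ 3`: `Σ ∖ i (B)` is a deformation retract of `Σ ∖ {i 0}`
(`BallComplement.homotopyEquiv`), which is simply connected. This is the fundamental-group half
of "`Σ` with the interior of a disc deleted is contractible" (Kosinski, *Differential Manifolds*
(1993), VI §1, remark before Cor. 1.4). [cite: Kosinski1993, Ch. VI §1 (remark before Cor. 1.4)] -/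
theorem simplyConnectedSpace_compl_image_ball (S : HomotopySphere n) (hn : 3 ≤ n)
    {i : 𝔼 n → S.carrier} (hi : Manifold.IsSmoothEmbedding 𝓘(ℝ, 𝔼 n) (𝓡 n) ∞ i) :
    SimplyConnectedSpace ↥((i '' ball (0 : 𝔼 n) 1)ᶜ) := by
  haveI := S.simplyConnectedSpace_compl_singleton hn (i 0)
  exact (Literature.AlgebraicTopology.Homotopy.BallComplement.homotopyEquiv
    (isOpenEmbedding_of_isSmoothEmbedding_euclidean hi)).simplyConnectedSpace

/-- **A homotopy `n`-sphere with the interior of a disc deleted is path connected** for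
`n ≥ 2` (it is a retract of the path connected `Σ ∖ {i 0}`). [folklore] -/
theorem isPathConnected_compl_image_ball (S : HomotopySphere n) (hn : 2 ≤ n)
    {i : 𝔼 n → S.carrier} (hi : Manifold.IsSmoothEmbedding 𝓘(ℝ, 𝔼 n) (𝓡 n) ∞ i) :
    IsPathConnected ((i '' ball (0 : 𝔼 n) 1)ᶜ : Set S.carrier) := by
  have hio := isOpenEmbedding_of_isSmoothEmbedding_euclidean hi
  haveI : PathConnectedSpace ↥(({i 0}ᶜ : Set S.carrier)) :=
    isPathConnected_iff_pathConnectedSpace.mp (S.isPathConnected_compl_singleton hn (i 0))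
  have hsurj : Surjective (Literature.AlgebraicTopology.Homotopy.BallComplement.retr (X := S.carrier) hio) := fun x =>
    ⟨Literature.AlgebraicTopology.Homotopy.BallComplement.incl x, Literature.AlgebraicTopology.Homotopy.BallComplement.retrFun_incl hio.isEmbedding x⟩
  rw [isPathConnected_iff_pathConnectedSpace, pathConnectedSpace_iff_univ, ← hsurj.range_eq]
  exact isPathConnected_range (Literature.AlgebraicTopology.Homotopy.BallComplement.retr (X := S.carrier) hio).continuous

end HomotopySphere

end Literature.Topology.FourManifolds
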